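/-
Copyright (c) 2026 the pub-hodgecm-mathlib formalisation cell (harness21).  Prover seat hodgecm-mathlib-K2Liu-p08 (g2), Track B «K2-LIT»,
#184♮ = hLiu418 = `stmt-HodgeConjecture-24832`; LEAD F0P6-plan (g12) RULING «M-156n» (3) 2026-09-04T08:09:40Z, gap G8 of K2Liu-p10 (g2)'s Φ9 census
`K2/K2Liu-p10/g2/CENSUS-Phi9-Assembly.K2Liu-p10-g2.md` §(iv); my census `K2/K2Liu-p08/g2/CENSUS-G7G8-HeightVsIwasawa.K2Liu-p08-g2.md`.
-/
import Summits.HodgeConjecture.HodgeConjecture.Theorems.K2LiuSiegelEisensteinMajorantCompact    -- ★ G1-END 1/4: `exists_summable_majorant_on_compact'`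
import Literature.NumberTheory.K2Lit.SiegelDoubledUnipotent                                     -- ★ `unipDelta` (Φ1's `hφc` currency)
import Mathlib.Analysis.Normed.Group.FunctionSeries
import HarnessLib

/-!
# Crux `HLiu418`, Road Φ, gap G8: THE CONVERGENT SIEGEL EISENSTEIN SERIES IS CONTINUOUS on Godement's half-plane `Re s > n/2`

Cell `hodgecm-mathlib`, crux item hLiu418 = `stmt-HodgeConjecture-24832`; LEAD F0P6-plan (g12) (M-156n (3)), co-dealer K2E5-plan (g6).  THEOREMS ONLY (no `def`,
no instance, no notation, no named-fact hypothesis, no `sorry`); lane `--supports stmt-HodgeConjecture-24832 --as helper` (count-neutral).  Consumers: Φ9-CORE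
(K2Liu-p10 (g2); clause (ii) of #41 on `{n/2 < re}` and the input `hφc` of ★ Φ1 `K2LiuSiegelFourierExpansionDelta.hasSum_fourierCoeffDelta` at `φ = E(·; f_s)`),
O41.4 (constant term), U5.

THE MATHEMATICS ([MoeglinWaldspurger1995, II.1.5]: «the series converges normally on every compact subset, so its sum is continuous»; [Garrett2018, §3.10]).
For a unitary `χ`, `Re s > n/2` and a CONTINUOUS Siegel section `f ∈ I(s, χ)` on `H(𝔸) = U(𝕍 ⊕ −𝕍)(𝔸)`, the Eisenstein series `h ↦ E(h; f) = Σ_γ f(γ h)`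
(★ `eisensteinSeriesDelta`) is continuous: every point has a compact neighbourhood (`H(𝔸)` is locally compact), on which ★ G1-END
`exists_summable_majorant_on_compact'` gives ONE summable majorant of the terms, and Weierstrass' `M`-test (Mathlib `continuousOn_tsum`) applies.
* `continuous_eisensteinSeriesDelta`, `continuous_eisensteinFamilyDelta` (family form);
* `continuous_eisensteinSeriesDelta_mul_right` (`u ↦ E(u·h; f)` on `H(𝔸)`), `continuous_eisensteinSeriesDelta_unipDelta_mul` (the same on `N_Δ(𝔸)` — verbatim the
  hypothesis `hφc` of ★ `hasSum_fourierCoeffDelta`).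
HONEST LABEL.  Count-neutral helper; `HC_CM` is proved only modulo the 7 printed citations (2 remaining named inputs: hLiu418 = `stmt-HodgeConjecture-24832`,
h413 = `stmt-HodgeConjecture-24833`) until rung 0 closes.
-/

set_option autoImplicit false
set_option linter.dupNamespace false -- the mandated namespace repeats `HodgeConjecture.HodgeConjecture`

noncomputable section

open NumberField NumberField.mixedEmbedding IsDedekindDomain Set
open scoped Topology

namespace Summit.HodgeConjecture.HodgeConjecture.Cruxes.HLiu418.K2LiuSiegelEisensteinContinuous

open Literature.NumberTheory.Automorphic Literature.NumberTheory.Automorphic.UnitaryGroup Literature.NumberTheory.GaloisRepresentations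
open Literature.NumberTheory.GelbartRogawski1991 Literature.NumberTheory.GelbartRogawski1991.GRConstruction
open Literature.NumberTheory.K2Lit.SiegelDoubled
open Summit.HodgeConjecture.HodgeConjecture.Cruxes.HLiu418.K2LiuSiegelEisensteinMajorantCompact

variable (L : Type) [Field L] [NumberField L] [IsCMField L]
variable {N M n : ℕ} (e : Fin N × Fin M ≃ Fin n)
  (dV : Fin N → L) (hdV : ∀ i, IsCMField.complexConj L (dV i) = dV i) (hdV0 : ∀ i, dV i ≠ 0)
  (dW : Fin M → L) (hdW : ∀ i, IsCMField.complexConj L (dW i) = dW i) (hdW0 : ∀ i, dW i ≠ 0)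

include hdV0 hdW0 in
/-- **THE CONVERGENT EISENSTEIN SERIES IS CONTINUOUS** (`χ` unitary, `Re s > n/2`, `f ∈ I(s, χ)` a continuous section): `h ↦ E(h; f)` is continuous on `H(𝔸)`
(compact neighbourhoods + ★ `exists_summable_majorant_on_compact'` + Weierstrass `M`-test). [cite: MoeglinWaldspurger1995, II.1.5] [cite: Garrett2018, §3.10 (Cor. 3.10.2)] -/
theorem continuous_eisensteinSeriesDelta {χ : HeckeCharacter L} (hχ : χ.IsUnitary) {s : ℂ} (hs : (n : ℝ) / 2 < s.re)
    {f : HA L e dV hdV dW hdW → ℂ} (hf : IsSiegelDeltaSection L e dV hdV dW hdW χ s f) (hfc : Continuous f) :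
    Continuous (eisensteinSeriesDelta L e dV hdV dW hdW f) := by
  refine continuous_iff_continuousAt.2 fun x₀ => ?_
  obtain ⟨K', hK'c, hK'n⟩ := exists_compact_mem_nhds x₀
  obtain ⟨u, hu, hb⟩ := exists_summable_majorant_on_compact' L e dV hdV hdV0 dW hdW hdW0 hχ hs hf hfc hK'c
  have hterm : ∀ q : SiegelDeltaQuot L e dV hdV dW hdW,
      ContinuousOn (fun x : HA L e dV hdV dW hdW => f (((Quotient.out q : ratH L e dV hdV dW hdW) : HA L e dV hdV dW hdW) * x)) K' := fun q =>
    (hfc.comp (continuous_const.mul continuous_id)).continuousOn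
  have hOn : ContinuousOn (fun x : HA L e dV hdV dW hdW => ∑' q : SiegelDeltaQuot L e dV hdV dW hdW,
      f (((Quotient.out q : ratH L e dV hdV dW hdW) : HA L e dV hdV dW hdW) * x)) K' :=
    continuousOn_tsum hterm hu fun q x hx => hb x hx q
  exact hOn.continuousAt hK'n

include hdV0 hdW0 in
/-- family form: `h ↦ E(h; f_s)` (★ `eisensteinFamilyDelta`) is continuous for `Re s > n/2` when `f_s ∈ I(s, χ)` is a continuous section.
[cite: MoeglinWaldspurger1995, II.1.5] -/
theorem continuous_eisensteinFamilyDelta {χ : HeckeCharacter L} (hχ : χ.IsUnitary) {f : ℂ → HA L e dV hdV dW hdW → ℂ}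
    (hf : ∀ s, IsSiegelDeltaSection L e dV hdV dW hdW χ s (f s)) (hfc : ∀ s, Continuous (f s)) (s : ℂ) (hs : (n : ℝ) / 2 < s.re) :
    Continuous (eisensteinFamilyDelta L e dV hdV dW hdW f s) :=
  continuous_eisensteinSeriesDelta L e dV hdV hdV0 dW hdW hdW0 hχ hs (hf s) (hfc s)

include hdV0 hdW0 in
/-- `u ↦ E(u·h; f)` is continuous on `H(𝔸)` for every `h`. [cite: MoeglinWaldspurger1995, II.1.5] -/
theorem continuous_eisensteinSeriesDelta_mul_right {χ : HeckeCharacter L} (hχ : χ.IsUnitary) {s : ℂ} (hs : (n : ℝ) / 2 < s.re)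
    {f : HA L e dV hdV dW hdW → ℂ} (hf : IsSiegelDeltaSection L e dV hdV dW hdW χ s f) (hfc : Continuous f) (h : HA L e dV hdV dW hdW) :
    Continuous fun u : HA L e dV hdV dW hdW => eisensteinSeriesDelta L e dV hdV dW hdW f (u * h) :=
  (continuous_eisensteinSeriesDelta L e dV hdV hdV0 dW hdW hdW0 hχ hs hf hfc).comp (continuous_id.mul continuous_const)

include hdV0 hdW0 in
/-- **Φ1's input `hφc` at `φ = E(·; f)`**: `u ↦ E(u·h; f)` is continuous on the unipotent radical `N_Δ(𝔸)` (★ `unipDelta`) — verbatim the hypothesis of ★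
`K2LiuSiegelFourierExpansionDelta.hasSum_fourierCoeffDelta`. [cite: MoeglinWaldspurger1995, II.1.5, I.2.6] -/
theorem continuous_eisensteinSeriesDelta_unipDelta_mul {χ : HeckeCharacter L} (hχ : χ.IsUnitary) {s : ℂ} (hs : (n : ℝ) / 2 < s.re)
    {f : HA L e dV hdV dW hdW → ℂ} (hf : IsSiegelDeltaSection L e dV hdV dW hdW χ s f) (hfc : Continuous f) (h : HA L e dV hdV dW hdW) :
    Continuous fun u : unipDelta L e dV hdV dW hdW => eisensteinSeriesDelta L e dV hdV dW hdW f ((u : HA L e dV hdV dW hdW) * h) :=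
  (continuous_eisensteinSeriesDelta L e dV hdV hdV0 dW hdW hdW0 hχ hs hf hfc).comp (continuous_subtype_val.mul continuous_const)

end Summit.HodgeConjecture.HodgeConjecture.Cruxes.HLiu418.K2LiuSiegelEisensteinContinuous

end
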